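import Summits.Ventures.PercRepro.RankLevelSetCoreSevenOfFormS345
import Summits.Ventures.PercRepro.S2TelescopeCount
import Summits.Ventures.PercRepro.RankLevelSetNullitySplitK
import Summits.Ventures.PercRepro.RankLevelSetNullitySplitY
import Summits.Ventures.PercRepro.RankLevelSetTelFormKY
import Summits.Ventures.PercRepro.S2TelescopeCount7
import Summits.Ventures.PercRepro.S1IndepSevenCount
import Summits.Ventures.PercRepro.S2GiantAllLevels
import Summits.Ventures.PercRepro.RankLevelSetSplitKYCount
import Summits.Ventures.PercRepro.RankLevelSetNullitySplitKY2

/-!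
# PercRepro — THE `e`-FREE CORE AT LEVEL `7` FROM A NUMERIC FORM: THE `k`-STEP NULLITY SPLIT WITH PER-BRANCH CONSTANTS
AND THE REFINED BRANCH COUNTS (p8, gen 24; a feeder for S4 — the giant band `(p, d ≈ 70)` of the rows `≤ 37` of the
`q = 7` window)

`c025_core_seven_of_form_splitky2` = `c025_core_seven_of_form_splitky` (RankLevelSetCoreSevenOfFormSplitKY) with
* ONE pair `(c₁, c₂)` for the count case (every set of rank `≤ 7` has nullity `≤ d − k`: `nsideTelK7` and the capped
  or the count-based tail, unchanged) and a SEPARATE pair for every branch `i < k` (a set `X` of rank `≤ 7` with nullity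
  `d − i`);
* in the branch `i` the `U`-side `2^{min 79 (7 + d)} + min (2^{7+d−i}) A₆ · Σ_{j ≤ i} C(n, j)` (the counted sets inside
  `cl X`, or with a rank-`≤ 6` part in `X` and `≤ i` points outside; `topCount_le_two_pow_add_of_nullity_ge`) instead of
  `2^{7+d−i}·Σ_{j ≤ i} C(n, j)`, and the spanning sets `(Σ_{j ≤ i} C(n, j))·2^{7+d−i}`
  (`ncard_spanning_le_of_nullity_ge`) instead of the crude `Σ_{j ≤ d} C(n, j)`.
In the giant band (`d ≈ 70`, `n ≈ 3p`) the old form fails because the crude spanning count is `0.9999·2^n` in EVERY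
branch while the count case's giant term `2^{min 79 (7 + d − k)}` needs `k ≥ 2`: with the branches priced on their own
the cells `(37, 71 … 73)` and `(36, 69 … 75)` close. Axioms: standard.
-/

set_option exponentiation.threshold 1024

open scoped Matroid

namespace PercRepro

namespace ThmN

open Set

variable {α : Type}

/-- **The `e`-free core at level `7` from a numeric form, the `k`-step split with PER-BRANCH constants and the refined
branch counts**: the form of the cell `(p, d)` is `k`, a pair `(c₁, c₂)` for the count case (`c₁·nsideTelK7 p d k S3 S4 S5
≤ c₂·2^{d−7}·C(p+7, 7)` and the capped `Y`-tail or, for `47 ≤ d`, the count-based tail) and, for every branch `i < k`, a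
pair with `c₁·(2^{min 79 (7+d)} + min (2^{7+d−i}) A₆ · Σ_{j ≤ i} C(n, j)) ≤ c₂·2^{d−7}·C(p+7, 7)` and the branch tail
`c₁·(2^{7+d−i}·Σ_{j ≤ 7+i} C(p − 7 + i, j) + (Σ_{j ≤ i} C(n, j))·2^{7+d−i}) ≤ (c₁ − c₂)·2^n`; `7 ≤ p`, `13 ≤ n`. -/
theorem c025_core_seven_of_form_splitky2 (M : Matroid α) [M.Finite] (p d S3 S4 S5 : ℕ) (hd8 : 8 ≤ d)
    (hR : M.eRank = (p : ℕ∞)) (hn : M.E.ncard = p + d)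
    (hfree : ∀ e ∈ M.E, ∃ A ⊆ M.E \ {e}, e ∉ M.closure A ∧ e ∉ M.closure ((M.E \ {e}) \ A))
    (hs3 : {C | M.IsCircuit C ∧ C.ncard = 3}.ncard ≤ S3)
    (hs4 : {C | M.IsCircuit C ∧ C.ncard = 4}.ncard ≤ S4)
    (hs5 : {C | M.IsCircuit C ∧ C.ncard = 5}.ncard ≤ S5)
    (hp7 : 7 ≤ p) (hn13 : 13 ≤ p + d)
    (hform :
      ∃ k : ℕ,
      (∃ c₁ c₂ : ℕ, 0 < c₂ ∧ c₂ < c₁ ∧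
        ((c₁ : ℕ) : ℚ) * nsideTelK7 p d k S3 S4 S5 ≤ ((c₂ : ℕ) : ℚ) * 2 ^ (d - 7) * (((p + 7).choose 7 : ℕ) : ℚ) ∧
        ((c₁ * ((p + d).choose 7 * 2 ^ (min 72 d) + (p + d).choose 6 * 2 ^ (min 33 d) + (p + d).choose 5 * 2 ^ (min 14 d) + (p + d).choose 4 * 2 ^ 6 + (p + d).choose 3 * 2 ^ 3 + (p + d).choose 2 * 2 + (p + d) + 1 + ∑ j ∈ Finset.range (d + 1), (p + d).choose j) ≤ (c₁ - c₂) * 2 ^ (p + d)) ∨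
          (47 ≤ d ∧
          (((c₁ : ℕ) : ℚ) * ((nsideTelK7 p d k S3 S4 S5 + 2 ^ (min 79 (7 + d - k))) +
            (((p + d).choose 6 * 2 ^ (min 33 d) + (p + d).choose 5 * 2 ^ (min 14 d) + (p + d).choose 4 * 2 ^ 6 + (p + d).choose 3 * 2 ^ 3 + (p + d).choose 2 * 2 + (p + d) + 1 + ∑ j ∈ Finset.range (d + 1), (p + d).choose j : ℕ) : ℚ)) ≤
            ((c₁ - c₂ : ℕ) : ℚ) * 2 ^ (p + d))))) ∧
      (∀ i < k, ∃ c₁ c₂ : ℕ, 0 < c₂ ∧ c₂ < c₁ ∧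
        c₁ * (2 ^ (min 79 (7 + d)) + min (2 ^ (7 + d - i)) ((p + d).choose 6 * 2 ^ (min 33 d) + (p + d).choose 5 * 2 ^ (min 14 d) + (p + d).choose 4 * 2 ^ 6 + (p + d).choose 3 * 2 ^ 3 + (p + d).choose 2 * 2 + (p + d) + 1) * ∑ j ∈ Finset.range (i + 1), (p + d).choose j) ≤
          c₂ * 2 ^ (d - 7) * (p + 7).choose 7 ∧
        c₁ * (2 ^ (7 + d - i) * (∑ j ∈ Finset.range (7 + i + 1), (p + d - (7 + d - i)).choose j) +
          (∑ j ∈ Finset.range (i + 1), (p + d).choose j) * 2 ^ (7 + d - i)) ≤ (c₁ - c₂) * 2 ^ (p + d))) :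
    RLS M p 7 := by
  classical
  have hEcard : M.ground_finite.toFinset.card = p + d := by
    rw [← Set.ncard_eq_toFinset_card _ M.ground_finite]; exact hn
  -- the core is simple: every circuit has `≥ 3` elements
  have hL0 : ∀ e ∈ M.E, ¬ M.IsLoop e := not_isLoop_of_free M hfree
  have hs : ∀ e ∈ M.E, ∀ f ∈ M.E, e ≠ f → M.eRk {e, f} = 2 := by
    intro e he f hf hef
    have h2 : (2 : ℕ∞) ≤ M.eRk {e, f} :=
      two_le_eRk_of_two_le_ncard_of_free M hfree (pair_subset he hf) (by rw [ncard_pair hef])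
    have h3 : M.eRk {e, f} ≤ 2 := by
      have := M.eRk_le_encard {e, f}
      rwa [encard_pair hef] at this
    exact le_antisymm h3 h2
  have hcirc : ∀ C, M.IsCircuit C → 3 ≤ C.encard := three_le_encard_of_circuit M hL0 hs
  have hd : M.E.encard = M.eRank + d := by
    rw [hR, ← M.ground_finite.cast_ncard_eq, hn]
    push_cast
    ring
  -- the nullity cap: every `X ⊆ E` has `|X| ≤ r(X) + d`
  have hcap : ∀ X ⊆ M.E, ∀ k : ℕ, M.eRk X ≤ k → X.ncard ≤ k + d := by
    intro X hX k hr
    have h1 := Matroid.encard_le_eRk_add_of_encard_eq hX hd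
    have h2 : X.encard ≤ (k : ℕ∞) + d := h1.trans (by gcongr)
    have hfin : X.Finite := M.ground_finite.subset hX
    rw [← hfin.cast_ncard_eq] at h2
    exact_mod_cast h2
  -- rank-`≤ 7` sets have `≤ min 79 (7 + d)` points, rank-`≤ 6` sets `≤ min 39 (6 + d)`
  have hflat : ∀ X ⊆ M.E, M.eRk X ≤ 7 → X.ncard ≤ min 79 (7 + d) :=
    fun X hX hr => le_min (ncard_le_seventynine_of_eRk_le_seven_of_free M hfree X hX hr) (hcap X hX 7 hr)
  have hflat' : ∀ X ⊆ M.E, M.eRk X ≤ ((7 - 1 : ℕ) : ℕ∞) → X.ncard ≤ min 39 (6 + d) :=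
    fun X hX hr => le_min (ncard_le_thirtynine_of_eRk_le_six_of_free M hfree hX (by simpa using hr))
      (hcap X hX 6 (by simpa using hr))
  have hinter := hinter_seven M hd hfree
  -- the flat bounds of the `e`-free core at every rank `≤ 6`
  have hC1 : ∀ L ⊆ M.E, M.eRk L = 2 → L.ncard ≤ 3 :=
    fun L hL hr => ncard_le_three_of_eRk_two M hs hfree hL hr
  have hC2 : ∀ P ⊆ M.E, M.eRk P ≤ 3 → P.ncard ≤ 6 :=
    fun P hP hr => ncard_le_six_of_eRk_le_three_of_free M hfree hP hr
  have hf0 : ∀ X ⊆ M.E, M.eRk X ≤ 0 → X.ncard ≤ 0 := fun X hX hr => by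
    have := ncard_add_one_le_two_pow_of_eRk_le M hL0 hfree 0 X hX (by exact_mod_cast hr)
    omega
  have hf1 : ∀ X ⊆ M.E, M.eRk X ≤ 1 → X.ncard ≤ 1 := fun X hX hr => by
    have := ncard_add_one_le_two_pow_of_eRk_le M hL0 hfree 1 X hX (by exact_mod_cast hr)
    omega
  have hf2 : ∀ X ⊆ M.E, M.eRk X ≤ 2 → X.ncard ≤ 3 := fun X hX hr => by
    have := ncard_add_one_le_two_pow_of_eRk_le M hL0 hfree 2 X hX (by exact_mod_cast hr)
    omega
  have hf4 : ∀ X ⊆ M.E, M.eRk X ≤ 4 → X.ncard ≤ 10 :=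
    fun X hX hr => ncard_le_ten_of_eRk_le_four_of_free M hfree hX hr
  have hf5 : ∀ X ⊆ M.E, M.eRk X ≤ 5 → X.ncard ≤ 19 :=
    fun X hX hr => ncard_le_nineteen_of_eRk_le_five_of_free M hfree hX hr
  have hf6 : ∀ X ⊆ M.E, M.eRk X ≤ 6 → X.ncard ≤ 39 :=
    fun X hX hr => ncard_le_thirtynine_of_eRk_le_six_of_free M hfree hX hr
  -- the non-coloop bound on every level set
  have hcol : ∀ m, 7 + 1 ≤ m → m ≤ d → ∀ B ∈ Matroid.levelF M 7 m,
      (fun ν => ν + S2.rminF ν) (m - 7) ≤ (S2.nonColoops M 7 B).card := by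
    intro m hm _ B hB
    rw [Matroid.levelF, Finset.mem_filter, Finset.mem_powersetCard] at hB
    obtain ⟨⟨hBsub, hBcard⟩, hBr⟩ := hB
    have hBE : (B : Set α) ⊆ M.E := by
      rw [← Matroid.coe_groundF M]; exact_mod_cast hBsub
    have := S2.card_nonColoops_ge_of_flat_bounds (M := M) B hBE (by exact_mod_cast hBr) (by omega)
      hf0 hf1 hf2 hC2 hf4 hf5 hf6
    rw [hBcard] at this
    exact this
  have hρ : ∀ ν, 1 ≤ (fun ν => ν + S2.rminF ν) (ν + 1) := fun ν => by
    have := S2.one_le_rminF (ν + 1)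
    simp only
    omega
  -- the circuit counts beyond `5`: the nullity bounds
  have hs6 : {C | M.IsCircuit C ∧ C.ncard = 6}.ncard ≤ (d + 5).choose 6 :=
    Matroid.ncard_circuits_le_choose_of_encard M hd 5
  have hs7 : {C | M.IsCircuit C ∧ C.ncard = 7}.ncard ≤ (d + 6).choose 7 :=
    Matroid.ncard_circuits_le_choose_of_encard M hd 6
  have hs8 : {C | M.IsCircuit C ∧ C.ncard = 8}.ncard ≤ (d + 7).choose 8 :=
    Matroid.ncard_circuits_le_choose_of_encard M hd 7
  -- (U): the telescoping count, in `ℚ`, then the circuit bounds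
  have hU1 := Matroid.topCount_le_ncard_compl (M := M) hR hd 7
  -- (Y): the rank-`≤ 7` sets through their closures; the spanning sets by the `5/2` tail
  have hY := Matroid.two_pow_le_midCount_add (M := M) p 7 hR
  have hsum7 := S2.ncard_eRk_le_le_sum M 7
  simp only [Finset.sum_range_succ, Finset.sum_range_zero, zero_add] at hsum7
  have hB := Matroid.ncard_spanning_le (M := M) hd
  rw [hEcard] at hY hB
  obtain ⟨k, ⟨c₁, c₂, hc₂, hc₁₂, hN, hT⟩, hbr⟩ := hform
  have h7 : {X : Set α | X ⊆ M.E ∧ M.eRk X = (7 : ℕ)}.ncard ≤ M.E.ncard.choose 7 * 2 ^ (min 72 d) := by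
    have := S2.ncard_eRk_eq_le_choose_mul_two_pow M 7 (min 79 (7 + d))
      (fun X hX hr => hflat X hX (by exact_mod_cast hr))
    rwa [show min 79 (7 + d) - 7 = min 72 d by omega] at this
  have h6 : {X : Set α | X ⊆ M.E ∧ M.eRk X = (6 : ℕ)}.ncard ≤ M.E.ncard.choose 6 * 2 ^ (min 33 d) := by
    have := S2.ncard_eRk_eq_le_choose_mul_two_pow M 6 (min 39 (6 + d))
      (fun X hX hr => le_min (ncard_le_thirtynine_of_eRk_le_six_of_free M hfree hX (by exact_mod_cast hr))
        (hcap X hX 6 (by exact_mod_cast hr)))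
    rwa [show min 39 (6 + d) - 6 = min 33 d by omega] at this
  have h5 : {X : Set α | X ⊆ M.E ∧ M.eRk X = (5 : ℕ)}.ncard ≤ M.E.ncard.choose 5 * 2 ^ (min 14 d) := by
    have := S2.ncard_eRk_eq_le_choose_mul_two_pow M 5 (min 19 (5 + d))
      (fun X hX hr => le_min (ncard_le_nineteen_of_eRk_le_five_of_free M hfree hX (by exact_mod_cast hr))
        (hcap X hX 5 (by exact_mod_cast hr)))
    rwa [show min 19 (5 + d) - 5 = min 14 d by omega] at this
  have h4 : {X : Set α | X ⊆ M.E ∧ M.eRk X = (4 : ℕ)}.ncard ≤ M.E.ncard.choose 4 * 2 ^ (10 - 4) :=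
    S2.ncard_eRk_eq_le_choose_mul_two_pow M 4 10
      (fun X hX hr => ncard_le_ten_of_eRk_le_four_of_free M hfree hX (by exact_mod_cast hr))
  have h3 : {X : Set α | X ⊆ M.E ∧ M.eRk X = (3 : ℕ)}.ncard ≤ M.E.ncard.choose 3 * 2 ^ (6 - 3) :=
    S2.ncard_eRk_eq_le_choose_mul_two_pow M 3 6
      (fun X hX hr => ncard_le_six_of_eRk_le_three_of_free M hfree hX (by exact_mod_cast hr))
  have h2 : {X : Set α | X ⊆ M.E ∧ M.eRk X = (2 : ℕ)}.ncard ≤ M.E.ncard.choose 2 * 2 ^ (3 - 2) :=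
    S2.ncard_eRk_eq_le_choose_mul_two_pow M 2 3
      (fun X hX hr => by
        have := ncard_add_one_le_two_pow_of_eRk_le M hL0 hfree 2 X hX hr
        omega)
  have h1 : {X : Set α | X ⊆ M.E ∧ M.eRk X = (1 : ℕ)}.ncard ≤ M.E.ncard.choose 1 * 2 ^ (1 - 1) :=
    S2.ncard_eRk_eq_le_choose_mul_two_pow M 1 1
      (fun X hX hr => by
        have := ncard_add_one_le_two_pow_of_eRk_le M hL0 hfree 1 X hX hr
        omega)
  have h0 : {X : Set α | X ⊆ M.E ∧ M.eRk X = (0 : ℕ)}.ncard ≤ M.E.ncard.choose 0 * 2 ^ (0 - 0) :=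
    S2.ncard_eRk_eq_le_choose_mul_two_pow M 0 0
      (fun X hX hr => by
        have := ncard_add_one_le_two_pow_of_eRk_le M hL0 hfree 0 X hX hr
        omega)
  simp only [Nat.choose_one_right, Nat.choose_zero_right, Nat.sub_self, pow_zero, mul_one] at h1 h0
  rw [hn] at h7 h6 h5 h4 h3 h2 h1
  push_cast at hsum7 h7 h6 h5 h4 h3 h2 h1 h0
  have hA : {X : Set α | X ⊆ M.E ∧ M.eRk X ≤ 7}.ncard ≤
      (p + d).choose 7 * 2 ^ (min 72 d) + (p + d).choose 6 * 2 ^ (min 33 d) + (p + d).choose 5 * 2 ^ (min 14 d) +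
        (p + d).choose 4 * 2 ^ 6 + (p + d).choose 3 * 2 ^ 3 + (p + d).choose 2 * 2 + (p + d) + 1 := by
    omega
  have hG : {X : Set α | X ⊆ M.E ∧ M.eRk X ≤ 7}.ncard + {X : Set α | X ⊆ M.E ∧ M.eRk X = M.eRank}.ncard ≤
      (p + d).choose 7 * 2 ^ (min 72 d) + (p + d).choose 6 * 2 ^ (min 33 d) + (p + d).choose 5 * 2 ^ (min 14 d) +
        (p + d).choose 4 * 2 ^ 6 + (p + d).choose 3 * 2 ^ 3 + (p + d).choose 2 * 2 + (p + d) + 1 +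
        ∑ j ∈ Finset.range (d + 1), (p + d).choose j := by
    omega
  -- (Φ) and the polynomial inequality
  have hΦ := phiK_le_two_pow_div p 7
  rw [Nat.choose_symm_add] at hΦ
  rw [RLS_iff]
  have hYq : (2 : ℚ) ^ (p + d) ≤ (Matroid.midCount M p 7 : ℚ) +
      ({X : Set α | X ⊆ M.E ∧ M.eRk X ≤ 7}.ncard : ℚ) +
      ({X : Set α | X ⊆ M.E ∧ M.eRk X = M.eRank}.ncard : ℚ) := by exact_mod_cast hY
  have hU0' : (0 : ℚ) ≤ (Matroid.topCount M p 7 : ℚ) := Nat.cast_nonneg _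
  have hd7 : 7 ≤ d := by omega
  have hc1q : (0 : ℚ) ≤ (c₁ : ℚ) := Nat.cast_nonneg _
  -- the old `Y`-bound (always valid), for the count case
  have hABold : (c₁ : ℚ) * (({X : Set α | X ⊆ M.E ∧ M.eRk X ≤ 7}.ncard : ℚ) +
      ({X : Set α | X ⊆ M.E ∧ M.eRk X = M.eRank}.ncard : ℚ)) ≤ ((c₁ - c₂ : ℕ) : ℚ) * 2 ^ (p + d) ∨
      (47 ≤ d ∧ (((c₁ : ℕ) : ℚ) * ((nsideTelK7 p d k S3 S4 S5 + 2 ^ (min 79 (7 + d - k))) +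
          (((p + d).choose 6 * 2 ^ (min 33 d) + (p + d).choose 5 * 2 ^ (min 14 d) + (p + d).choose 4 * 2 ^ 6 + (p + d).choose 3 * 2 ^ 3 + (p + d).choose 2 * 2 + (p + d) + 1 + ∑ j ∈ Finset.range (d + 1), (p + d).choose j : ℕ) : ℚ)) ≤
          ((c₁ - c₂ : ℕ) : ℚ) * 2 ^ (p + d))) := by
    rcases hT with hTold | hTnew
    · left
      have hG : {X : Set α | X ⊆ M.E ∧ M.eRk X ≤ 7}.ncard + {X : Set α | X ⊆ M.E ∧ M.eRk X = M.eRank}.ncard ≤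
          (p + d).choose 7 * 2 ^ (min 72 d) + (p + d).choose 6 * 2 ^ (min 33 d) + (p + d).choose 5 * 2 ^ (min 14 d) +
            (p + d).choose 4 * 2 ^ 6 + (p + d).choose 3 * 2 ^ 3 + (p + d).choose 2 * 2 + (p + d) + 1 +
            ∑ j ∈ Finset.range (d + 1), (p + d).choose j := by
        omega
      exact_mod_cast le_trans (Nat.mul_le_mul_left _ hG) hTold
    · right; exact hTnew
  -- the rank-`≤ 6` sets, for the branches
  have hsum6 := S2.ncard_eRk_le_le_sum M 6
  simp only [Finset.sum_range_succ, Finset.sum_range_zero, zero_add] at hsum6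
  push_cast at hsum6
  have hA6' : {X : Set α | X ⊆ M.E ∧ M.eRk X ≤ 6}.ncard ≤
      (p + d).choose 6 * 2 ^ (min 33 d) + (p + d).choose 5 * 2 ^ (min 14 d) + (p + d).choose 4 * 2 ^ 6 +
        (p + d).choose 3 * 2 ^ 3 + (p + d).choose 2 * 2 + (p + d) + 1 := by
    omega
  -- the sets of rank `≤ 6`
  have hA6 : {X : Set α | X ⊆ M.E ∧ M.eRk X ≤ 7}.ncard ≤ {X : Set α | X ⊆ M.E ∧ M.eRk X = 7}.ncard +
      ((p + d).choose 6 * 2 ^ (min 33 d) + (p + d).choose 5 * 2 ^ (min 14 d) + (p + d).choose 4 * 2 ^ 6 +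
        (p + d).choose 3 * 2 ^ 3 + (p + d).choose 2 * 2 + (p + d) + 1) := by
    omega
  have hBq : ({X : Set α | X ⊆ M.E ∧ M.eRk X = M.eRank}.ncard : ℚ) ≤
      ((∑ j ∈ Finset.range (d + 1), (p + d).choose j : ℕ) : ℚ) := by exact_mod_cast hB
  -- THE CASE SPLIT, once for both sides
  by_cases hBcase : ∃ X ⊆ M.E, M.eRk X ≤ 7 ∧ M.eRk X + d < (X.ncard : ℕ∞) + k
  · -- some set of rank `≤ 7` has nullity `d − i` with `i < k`
    obtain ⟨X, hX, hXr, hlt⟩ := hBcase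
    have hXfin : X.Finite := M.ground_finite.subset hX
    have hne : M.eRk X ≠ ⊤ := ((M.eRk_le_encard _).trans_lt hXfin.encard_lt_top).ne
    obtain ⟨r, hr⟩ := ENat.ne_top_iff_exists.1 hne
    have hXc : X.ncard ≤ 7 + d := hcap X hX 7 hXr
    rw [← hr] at hlt hXr
    have e1 : r + d < X.ncard + k := by exact_mod_cast hlt
    have e2 : r ≤ 7 := by exact_mod_cast hXr
    have hcapX : X.ncard ≤ r + d := by
      have := PercRepro.Matroid.encard_le_eRk_add_of_encard_eq hX hd
      rw [← hr, ← hXfin.cast_ncard_eq] at this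
      exact_mod_cast this
    set i := r + d - X.ncard with hi
    have hik : i < k := by omega
    have hnul : M.eRk X + d ≤ (X.ncard : ℕ∞) + i := by
      rw [← hr]
      have : r + d ≤ X.ncard + i := by omega
      exact_mod_cast this
    have hXi : X.ncard ≤ 7 + d - i := by omega
    -- the branch's own constants
    obtain ⟨c₁', c₂', hc₂', hc₁₂', hN', hT'⟩ := hbr i hik
    have hc1q' : (0 : ℚ) ≤ (c₁' : ℚ) := Nat.cast_nonneg _
    -- the `U`-side through the closure of `X`
    have hclX : (M.closure X).ncard ≤ min 79 (7 + d) := by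
      refine hflat (M.closure X) (M.closure_subset_ground X) ?_
      rw [M.eRk_closure_eq, ← hr]
      exact hXr
    have htop := topCount_le_two_pow_add_of_nullity_ge M hR hd hX hnul hclX hA6'
    rw [hn] at htop
    have hmono : min (2 ^ X.ncard) ((p + d).choose 6 * 2 ^ (min 33 d) + (p + d).choose 5 * 2 ^ (min 14 d) +
        (p + d).choose 4 * 2 ^ 6 + (p + d).choose 3 * 2 ^ 3 + (p + d).choose 2 * 2 + (p + d) + 1) ≤
        min (2 ^ (7 + d - i)) ((p + d).choose 6 * 2 ^ (min 33 d) + (p + d).choose 5 * 2 ^ (min 14 d) +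
        (p + d).choose 4 * 2 ^ 6 + (p + d).choose 3 * 2 ^ 3 + (p + d).choose 2 * 2 + (p + d) + 1) :=
      min_le_min (Nat.pow_le_pow_right (by norm_num) hXi) le_rfl
    have htop' : Matroid.topCount M p 7 ≤ 2 ^ (min 79 (7 + d)) + min (2 ^ (7 + d - i))
        ((p + d).choose 6 * 2 ^ (min 33 d) + (p + d).choose 5 * 2 ^ (min 14 d) + (p + d).choose 4 * 2 ^ 6 +
          (p + d).choose 3 * 2 ^ 3 + (p + d).choose 2 * 2 + (p + d) + 1) * ∑ j ∈ Finset.range (i + 1), (p + d).choose j :=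
      htop.trans (Nat.add_le_add_left (Nat.mul_le_mul_right _ hmono) _)
    have hmain : (c₁' : ℚ) * (Matroid.topCount M p 7 : ℚ) ≤ (c₂' : ℚ) * 2 ^ (d - 7) * (((p + 7).choose 7 : ℕ) : ℚ) := by
      have h := le_trans (Nat.mul_le_mul_left c₁' htop') hN'
      exact_mod_cast h
    -- the `Y`-side: the sets of rank `≤ 7` through `X`, the spanning sets through the coindependence bound
    have hABq : (c₁' : ℚ) * (({X : Set α | X ⊆ M.E ∧ M.eRk X ≤ 7}.ncard : ℚ) +
        ({X : Set α | X ⊆ M.E ∧ M.eRk X = M.eRank}.ncard : ℚ)) ≤ ((c₁' - c₂' : ℕ) : ℚ) * 2 ^ (p + d) := by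
      have hn7 : 7 + d - i ≤ M.E.ncard := by rw [hn]; omega
      have hAle := ncard_eRk_le_le_of_nullity_ge M hd hX hnul hXi hn7
      rw [hn] at hAle
      have hSp := ncard_spanning_le_of_nullity_ge M hd hX hnul
      rw [hn] at hSp
      have hSp' : {X : Set α | X ⊆ M.E ∧ M.eRk X = M.eRank}.ncard ≤
          (∑ j ∈ Finset.range (i + 1), (p + d).choose j) * 2 ^ (7 + d - i) :=
        hSp.trans (Nat.mul_le_mul_left _ (Nat.pow_le_pow_right (by norm_num) hXi))
      have hG : {X : Set α | X ⊆ M.E ∧ M.eRk X ≤ 7}.ncard + {X : Set α | X ⊆ M.E ∧ M.eRk X = M.eRank}.ncard ≤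
          2 ^ (7 + d - i) * (∑ j ∈ Finset.range (7 + i + 1), (p + d - (7 + d - i)).choose j) +
            (∑ j ∈ Finset.range (i + 1), (p + d).choose j) * 2 ^ (7 + d - i) := Nat.add_le_add hAle hSp'
      exact_mod_cast le_trans (Nat.mul_le_mul_left _ hG) hT'
    have hUq' : (Matroid.topCount M p 7 : ℚ) ≤ (((p + d).choose 7 : ℕ) : ℚ) +
        ((Matroid.topCount M p 7 : ℚ) - (((p + d).choose 7 : ℕ) : ℚ)) := by linarith
    have hpolyq' : (c₁' : ℚ) * ((((p + d).choose 7 : ℕ) : ℚ) +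
        ((Matroid.topCount M p 7 : ℚ) - (((p + d).choose 7 : ℕ) : ℚ))) ≤
        (c₂' : ℚ) * 2 ^ (d - 7) * (((p + 7).choose 7 : ℕ) : ℚ) := by
      have : (((p + d).choose 7 : ℕ) : ℚ) + ((Matroid.topCount M p 7 : ℚ) - (((p + d).choose 7 : ℕ) : ℚ)) =
          (Matroid.topCount M p 7 : ℚ) := by ring
      rw [this]; exact hmain
    exact level_arith_form (p := p) (d := d) (n := p + d) (q := 7) rfl hd7 hc₂' hc₁₂' hΦ hU0' hUq' hYq hABq hpolyq'
  · -- every set of rank `≤ 7` has nullity `≤ d − k`: the count with the caps `k` smaller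
    have hB' : ∀ X ⊆ M.E, M.eRk X ≤ 7 → (X.ncard : ℕ∞) + k ≤ M.eRk X + d :=
      fun X hX hr => le_of_not_gt (fun h => hBcase ⟨X, hX, hr, h⟩)
    have hflatK : ∀ X ⊆ M.E, M.eRk X ≤ 7 → X.ncard ≤ min 79 (7 + d - k) := by
      intro X hX hr
      refine le_min (hflat X hX hr |>.trans (min_le_left _ _)) ?_
      have hle := hB' X hX hr
      have hXfin : X.Finite := M.ground_finite.subset hX
      have hne : M.eRk X ≠ ⊤ := ((M.eRk_le_encard _).trans_lt hXfin.encard_lt_top).ne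
      obtain ⟨r, hr'⟩ := ENat.ne_top_iff_exists.1 hne
      rw [← hr'] at hle hr
      have e1 : X.ncard + k ≤ r + d := by exact_mod_cast hle
      have e2 : r ≤ 7 := by exact_mod_cast hr
      omega
    have hflat'K : ∀ X ⊆ M.E, M.eRk X ≤ ((7 - 1 : ℕ) : ℕ∞) → X.ncard ≤ min 39 (6 + d - k) := by
      intro X hX hr
      refine le_min (hflat' X hX hr |>.trans (min_le_left _ _)) ?_
      have hr7 : M.eRk X ≤ 7 := hr.trans (by norm_num)
      have hle := hB' X hX hr7
      have hXfin : X.Finite := M.ground_finite.subset hX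
      have hne : M.eRk X ≠ ⊤ := ((M.eRk_le_encard _).trans_lt hXfin.encard_lt_top).ne
      obtain ⟨r, hr'⟩ := ENat.ne_top_iff_exists.1 hne
      rw [← hr'] at hle hr
      have e1 : X.ncard + k ≤ r + d := by exact_mod_cast hle
      have e2 : r ≤ 6 := by exact_mod_cast hr
      omega
    -- the count with the independent `7`-sets at level `7`
    have hU0K := S2.ncard_eRk_eq_ncard_le_le_tel7 M 7 (min 79 (7 + d - k)) (min 39 (6 + d - k))
      (max ((d + min 33 d) / 2 + 1) (min 32 (d - 1) + 2)) (min 33 d) (fun ν => ν + S2.rminF ν)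
      (by norm_num) hcirc hC1 hC2 hflatK hflat'K hinter hd (by omega) (by omega) hρ hcol
    have hm1K : min (min 79 (7 + d - k) - (7 + 1)) (max ((d + min 33 d) / 2 + 1) (min 32 (d - 1) + 2) - 2) =
        min (min 79 (7 + d - k) - 8) (max ((d + min 33 d) / 2 + 1) (min 32 (d - 1) + 2) - 2) := rfl
    have hm3K : min (min 79 (7 + d - k)) (7 + d) = min 79 (7 + d - k) := by omega
    rw [hn, sum_Icc_three_eight_q, hm1K, hm3K] at hU0K
    simp only [show (7 : ℕ) + 1 = 8 from rfl, show (8 : ℕ) - 3 = 5 from rfl, show (8 : ℕ) - 4 = 4 from rfl,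
      show (8 : ℕ) - 5 = 3 from rfl, show (8 : ℕ) - 6 = 2 from rfl, show (8 : ℕ) - 7 = 1 from rfl,
      show (8 : ℕ) - 8 = 0 from rfl, Nat.choose_one_right, Nat.choose_zero_right] at hU0K
    -- the Bonferroni recombination: `#{r = 7, |B| ≤ d} ≤ nsideTelK7`
    have hcount7 : ({B : Set α | B ⊆ M.E ∧ M.eRk B = 7 ∧ B.ncard ≤ d}.ncard : ℚ) ≤ nsideTelK7 p d k S3 S4 S5 :=
      count_le_nsideTelK7 M p d k S3 S4 S5 hd8 hn hn13 hs3 hs4 hs5 hs6 hs7 hs8 hC1 hU0K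
    have hU1 := Matroid.topCount_le_ncard_compl (M := M) hR hd 7
    have hUq7 : (Matroid.topCount M p 7 : ℚ) ≤ nsideTelK7 p d k S3 S4 S5 :=
      (by exact_mod_cast hU1 : (Matroid.topCount M p 7 : ℚ) ≤
        ({B : Set α | B ⊆ M.E ∧ M.eRk B = 7 ∧ B.ncard ≤ d}.ncard : ℚ)).trans hcount7
    have hmain : (c₁ : ℚ) * (Matroid.topCount M p 7 : ℚ) ≤ (c₂ : ℚ) * 2 ^ (d - 7) * (((p + 7).choose 7 : ℕ) : ℚ) :=
      (mul_le_mul_of_nonneg_left hUq7 hc1q).trans hN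
    -- the `Y`-side
    have hABq : (c₁ : ℚ) * (({X : Set α | X ⊆ M.E ∧ M.eRk X ≤ 7}.ncard : ℚ) +
        ({X : Set α | X ⊆ M.E ∧ M.eRk X = M.eRank}.ncard : ℚ)) ≤ ((c₁ - c₂ : ℕ) : ℚ) * 2 ^ (p + d) := by
      rcases hABold with h | ⟨hd47, hcount⟩
      · exact h
      · have hall := S2.ncard_eRk_eq_le_ncard_le_add_two_pow (M := M) 7 (min 79 (7 + d - k)) (min 39 (6 + d - k))
          (max ((d + min 33 d) / 2 + 1) (min 32 (d - 1) + 2)) (min 33 d) (by norm_num) hcirc hC1 hC2 hflatK hflat'K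
          hinter hd (by omega) (by omega) (by omega)
        rw [hm3K] at hall
        push_cast at hall
        have hA7q : (({X : Set α | X ⊆ M.E ∧ M.eRk X = 7}.ncard : ℕ) : ℚ) ≤
            nsideTelK7 p d k S3 S4 S5 + 2 ^ (min 79 (7 + d - k)) := by
          have h1 : (({X : Set α | X ⊆ M.E ∧ M.eRk X = 7}.ncard : ℕ) : ℚ) ≤
              (({B : Set α | B ⊆ M.E ∧ M.eRk B = 7 ∧ B.ncard ≤ d}.ncard : ℕ) : ℚ) + (2 : ℚ) ^ (min 79 (7 + d - k)) := by
            exact_mod_cast hall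
          linarith
        have hA6q : (({X : Set α | X ⊆ M.E ∧ M.eRk X ≤ 7}.ncard : ℕ) : ℚ) ≤
            (({X : Set α | X ⊆ M.E ∧ M.eRk X = 7}.ncard : ℕ) : ℚ) +
            (((p + d).choose 6 * 2 ^ (min 33 d) + (p + d).choose 5 * 2 ^ (min 14 d) + (p + d).choose 4 * 2 ^ 6 +
              (p + d).choose 3 * 2 ^ 3 + (p + d).choose 2 * 2 + (p + d) + 1 : ℕ) : ℚ) := by exact_mod_cast hA6
        have hsum : (({X : Set α | X ⊆ M.E ∧ M.eRk X ≤ 7}.ncard : ℕ) : ℚ) +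
            ({X : Set α | X ⊆ M.E ∧ M.eRk X = M.eRank}.ncard : ℚ) ≤
            (nsideTelK7 p d k S3 S4 S5 + 2 ^ (min 79 (7 + d - k))) +
            (((p + d).choose 6 * 2 ^ (min 33 d) + (p + d).choose 5 * 2 ^ (min 14 d) + (p + d).choose 4 * 2 ^ 6 + (p + d).choose 3 * 2 ^ 3 + (p + d).choose 2 * 2 + (p + d) + 1 + ∑ j ∈ Finset.range (d + 1), (p + d).choose j : ℕ) : ℚ) := by
          push_cast at hA6q hBq ⊢
          linarith
        exact (mul_le_mul_of_nonneg_left hsum hc1q).trans hcount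
    have hUq' : (Matroid.topCount M p 7 : ℚ) ≤ (((p + d).choose 7 : ℕ) : ℚ) +
        ((Matroid.topCount M p 7 : ℚ) - (((p + d).choose 7 : ℕ) : ℚ)) := by linarith
    have hpolyq' : (c₁ : ℚ) * ((((p + d).choose 7 : ℕ) : ℚ) +
        ((Matroid.topCount M p 7 : ℚ) - (((p + d).choose 7 : ℕ) : ℚ))) ≤
        (c₂ : ℚ) * 2 ^ (d - 7) * (((p + 7).choose 7 : ℕ) : ℚ) := by
      have : (((p + d).choose 7 : ℕ) : ℚ) + ((Matroid.topCount M p 7 : ℚ) - (((p + d).choose 7 : ℕ) : ℚ)) =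
          (Matroid.topCount M p 7 : ℚ) := by ring
      rw [this]; exact hmain
    exact level_arith_form (p := p) (d := d) (n := p + d) (q := 7) rfl hd7 hc₂ hc₁₂ hΦ hU0' hUq' hYq hABq hpolyq'

end ThmN

end PercRepro
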